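import Summits.BirchSwinnertonDyer.BirchSwinnertonDyer.Theorems.EdixhovenFibreFiveSevenTwistDegreeStepOrdinaryOfSL2NeronValues
import Summits.BirchSwinnertonDyer.BirchSwinnertonDyer.Theorems.EdixhovenFibreFiveSevenStarredOptimalManinUnitFiveSevenAssemblyAtBar
import Literature.NumberTheory.EllipticCurves.DualExpEllipticReciprocityLaw
import HarnessLib

/-!
# Crux TDS11 `TwistDegreeStepOrdinary` (stmt-BirchSwinnertonDyer-22228) BY NAME, GRANTED ONLY {P1-bar, [REC-tower]} (or {P1-bar, hT₂})

Cell `pub/bsd-wall`, seat `bsd-line-edix-p1` g18 (LEAD of line `kato_lever`; `--supports` 22228 as a helper). TOOL theorems only; nothing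
is closed; BSD is not proved by any of this.

WHAT. Verbatim twin of `TwistDegreeStepOrdinaryOfSL2NeronValues.twistDegreeStepOrdinary_of_sl2NeronValues_of_expStarTower` (edix-p4 g9: TDS11
⟸ {P1, hT₂}, hDR discharged on the (G)-ordinary locus) with
* P1 read PRINT-FAITHFULLY — `Kato2004.exists_member_sl2ZetaElement_neron_values_bar` (DD-UE-1, p697548) through the twin opener
  `KatoAssemblySocketAt.katoNeronBody_of_sl2NeronValuesBar_of_isDeRhamAt` (F2) —: ★ `twistDegreeStepOrdinary_of_expStarTower_of_sl2NeronValuesBar`;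
* and hT₂ replaced by Kato's explicit reciprocity law [REC-tower] `tatePairingPoint_eq_trace_expStar_log_tower`
  (`exists_smul_range_expStarCoord_tower_iff_trace_log_of_reciprocityLaw`, p700964): ★★ `twistDegreeStepOrdinary_of_reciprocityLaw_of_sl2NeronValuesBar`.
So TDS11's printed inputs are {P1-bar, [REC-tower]} — the same as K★ (22226). CONDITIONAL; the item stays OPEN.

References: [Kato2004Asterisque] Thm. 6.6 (1), (8.1.3), Thm. 9.7; [Kato1993LNM1553] Ch. II Thm. 1.4.1 (4), Ex. 1.3.5; [EdixhovenManin1991] §4;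
[BrinonConrad2009] Prop. 6.3.8.
-/

set_option autoImplicit false
-- the Theorems namespace of a single-conjunct summit repeats the summit name by design (D-0017)
set_option linter.dupNamespace false

noncomputable section

open scoped Classical MatrixGroups NumberField

open WeierstrassCurve NumberField IsDedekindDomain Field ValuativeRel
  Literature.NumberTheory.EllipticCurves Literature.NumberTheory.EllipticCurves.ModularForms
  Literature.NumberTheory.EllipticCurves.Rank1Residual Literature.NumberTheory.EllipticCurves.Kato2004
  Literature.NumberTheory.DiophantineGeometry Rat.HeightOneSpectrum
  Literature.NumberTheory.PAdicHodge Literature.NumberTheory.GaloisRepresentations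
  Literature.NumberTheory.GaloisRepresentations.IsNonarchimedeanLocalField
  Summit.BirchSwinnertonDyer.Rank1Residual Summit.BirchSwinnertonDyer.Rank1Residual.Additive
  Summit.BirchSwinnertonDyer.BirchSwinnertonDyer.Theorems
  Summit.BirchSwinnertonDyer.BirchSwinnertonDyer.Theorems.KatoAssemblySocketAt
  Summit.BirchSwinnertonDyer.BirchSwinnertonDyer.Theorems.ManinFrameResidueProperRTameTwistAt
  Summit.BirchSwinnertonDyer.BirchSwinnertonDyer.Theorems.TwistDegreeStepOrdinaryOfSL2NeronValues
  CongruenceSubgroup Complex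

namespace Summit.BirchSwinnertonDyer.BirchSwinnertonDyer.Theorems.TwistDegreeStepOrdinaryOfReciprocityLaw

/-- ★ **TDS11 `TwistDegreeStepOrdinary` GRANTED ONLY P1-bar and hT₂** — the proof of
`twistDegreeStepOrdinary_of_sl2NeronValues_of_expStarTower` verbatim with the print-faithful opener
`katoNeronBody_of_sl2NeronValuesBar_of_isDeRhamAt`; hDR from `isDeRham_restrictedRationalTateRep_adicCompletion_rat_of_typeGOrd` at the frame's
(G)-ordinary member. CONDITIONAL; the item is not closed. [cite: Kato2004Asterisque, Thm. 6.6 (1) (p. 163), (8.1.3) (p. 180), Thm. 9.7 (p. 189)]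
[cite: EdixhovenManin1991, §4] [cite: Kato1993LNM1553, Ch. II Ex. 1.3.5] [cite: BrinonConrad2009, Prop. 6.3.8] -/
theorem twistDegreeStepOrdinary_of_expStarTower_of_sl2NeronValuesBar
    (hT₂ : exists_smul_range_expStarCoord_tower_iff_trace_log) (hP1 : exists_member_sl2ZetaElement_neron_values_bar) :
    Summit.BirchSwinnertonDyer.BirchSwinnertonDyer.Theses.EdixhovenFibreFiveSeven.TwistDegreeStepOrdinary := by
  intro hnf W _ _ p _ _ hp11 hadd hirr _hres _hall V _ _ _ Wf _ _ _ C hisoV hG hV4 hC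
  refine twistDegreeStep_of_tameTwistL_at hnf W hp11 hadd hirr ?_ V Wf C hisoV hG hV4 hC
  intro W₀ _ _ hiso₀ M _ g hg h7 hng hnm hirr' m _ hcop χ hχ hχ1 hord ϖ r
  have hisoVW₀ : IsIsogenous V W₀ := (hisoV.symm_of_charZero).trans' hiso₀
  refine katoNeronBody_of_sl2NeronValuesBar_of_isDeRhamAt hT₂ cupLogInjective_and_hasDualExp_of_isDeRham_holds hP1 W₀ p
    ?_ g hg (by omega) hng hnm hirr' m hcop (Or.inl h7) χ hχ hχ1 hord ϖ r
  intro v hpv _ _ _ hp' _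
  exact isDeRham_restrictedRationalTateRep_of_isIsogenous hp' hisoVW₀
    (isDeRham_restrictedRationalTateRep_adicCompletion_rat_of_typeGOrd V p hG v hpv hp')

/-- ★★ **TDS11 `TwistDegreeStepOrdinary` GRANTED ONLY P1-bar and Kato's explicit reciprocity law [REC-tower]** (hT₂ :=
`exists_smul_range_expStarCoord_tower_iff_trace_log_of_reciprocityLaw hrec`, p700964). CONDITIONAL; the item is not closed.
[cite: Kato1993LNM1553, Ch. II Thm. 1.4.1 (4), Lemma 1.4.3–1.4.5] [cite: Kato2004Asterisque, (8.1.3) (p. 180), Thm. 9.7 (p. 189)] -/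
theorem twistDegreeStepOrdinary_of_reciprocityLaw_of_sl2NeronValuesBar
    (hrec : tatePairingPoint_eq_trace_expStar_log_tower) (hP1 : exists_member_sl2ZetaElement_neron_values_bar) :
    Summit.BirchSwinnertonDyer.BirchSwinnertonDyer.Theses.EdixhovenFibreFiveSeven.TwistDegreeStepOrdinary :=
  twistDegreeStepOrdinary_of_expStarTower_of_sl2NeronValuesBar
    (exists_smul_range_expStarCoord_tower_iff_trace_log_of_reciprocityLaw hrec) hP1

end Summit.BirchSwinnertonDyer.BirchSwinnertonDyer.Theorems.TwistDegreeStepOrdinaryOfReciprocityLaw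

end
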